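import Summits.QuantumFields.QCD.Theorems.QuarksAsStableActionStableActionBridgeTimeSlice
import Summits.QuantumFields.QCD.Theorems.QuarksAsStableActionStableActionBridgeSliceSpin
import Literature.MathematicalPhysics.QuantumFieldTheory.QCDOS
import HarnessLib

/-!
# Stub `stub_diracMatrix_source_timeSlice` of line `pin-the-infimum` (crux `RobustYangMillsHandover`, 8892)

E2 (fermionic insertions in Lüscher's transfer form), layer γ0: **the `N_f`-flavour Wilson–Dirac
matrix with an equal-time source is a Wilson-type projector chain.**

For an `SU(3)` gauge field `U` on the four-torus `(ℤ/L)⁴`, quark masses `mq : Fin Nf → ℝ`, a time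
`t₀ : ℤ/L` and an arbitrary equal-time source block `Jsl` on the slice index
`X × colour × spin`, `X := flavour × (ℤ/L)³` (flavour is absorbed into the "site" factor, so
flavour-off-diagonal sources such as the pseudoscalars `ψ̄_f iγ₅ ψ_g`, `f ≠ g`, are covered), the
determinant of `diracMatrix U mq − s · J^{(t₀)}` (`J^{(t₀)}` = `Jsl` placed at the equal times
`x₀ = y₀ = t₀`, pulled back to the tree's linear index `FermiIdx` along `quarkEquiv`) equals the
determinant of the block matrix on `ℤ/L × (X × colour × spin)` whose `(t, s)` block is

* `A_t − [t = t₀] s · Jsl` for `s = t`, with the flavour-block-diagonal slice operator `A_t`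
  (mass `mq f + 4` on block `f` plus the `r = 1` spatial Wilson hops of slice `t`),
* the forward temporal hop `−P⁻ W_t` for `s = t + 1`, `W_t = 1_X ⊗ ρ(U((t,y),0)) ⊗ 1_spin`
  (block-diagonal in `X`, identity in spin),
* the backward temporal hop `−P⁺ W'_s` for `t = s + 1`, `W'_s` the same with `ρ(U((s,y),0))⁻¹`,

`P± = ½(1 ± γ₀)` on spin; together with the six algebraic facts the abstract chain determinant
`det_projChain` consumes: `W_t`, `W'_t` commute with the lifted `P±`, and
`W'_t W_t = W_t W'_t = 1`.
[cite: Luscher1977, pp. 283–292]; [cite: MontvayMunster1994, §5.1].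

## Proof

* `det M = det (M.submatrix e e)` for the time/flavour splitting equivalence
  `e : ℤ/L × (X × colour × spin) ≃ FermiIdx`, `e (t, ((f, y), c)) = quarkEquiv (f, ((t, y), c))`
  (`Matrix.det_submatrix_equiv_self`; the inverse is `x ↦ (x 0, Fin.tail x)` on the site).
* Entrywise identification.  Dirac part (`hD`): for equal flavours the entry of
  `wilsonDirac ρ U (mq f) 1` between the sites `Fin.cons t y` and `Fin.cons s z` is read off the
  landed one-flavour brick `wilsonDirac_submatrix_timeSlice`
  (`StubDiracMatrixSourceTimeSlice.wilsonDirac_cons_apply`, the Kronecker products `P∓ · W`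
  collapsed by `TimeSlice.spinLift_mul_colourLift`); for distinct flavours both sides vanish
  (`A_t` carries the flavour guard, the collapsed hops the guard `(f, y) = (g, z)`).  Source part
  (`hJ`): `(Fin.cons t y) 0 = t`, `Fin.tail (Fin.cons t y) = y`; then a scalar rearrangement
  (`StubDiracMatrixSourceTimeSlice.source_rearrange`).
* The six commutation / inverse facts are the Kronecker bookkeeping of the landed
  `SliceSpin.of_spin_eq`, `SliceSpin.of_colour_eq`, `SliceSpin.of_colour_mul_of_colour_eq_one`
  with site factor `X = Fin Nf × TorusSite 3 L`
  (`StubDiracMatrixSourceTimeSlice.colourLift_comm_spinLift`,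
  `StubDiracMatrixSourceTimeSlice.colourLift_mul_colourLift_eq_one`) and
  `ρ(g⁻¹) ρ(g) = ρ(g) ρ(g⁻¹) = 1`.

Pure theorem file (no definitions); Mathlib plus the tree's `StableActionBridge.Sketch` bricks.

References: M. Lüscher, *Construction of a selfadjoint, strictly positive transfer matrix for
Euclidean lattice gauge theories*, Comm. Math. Phys. 54 (1977) 283–292; I. Montvay, G. Münster,
*Quantum Fields on a Lattice* (CUP 1994), §4.2 (4.85), §5.1.
-/

namespace Summit.QuantumFields.QCD.Cruxes.RobustYangMillsHandover.PinTheInfimum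

open Literature.MathematicalPhysics.QuantumLattice Literature.MathematicalPhysics.QuantumFieldTheory
open Literature.Probability.LatticeModels (TorusSite)
open Summit.QuantumFields.QCD.Cruxes.StableActionBridge.Sketch

namespace StubDiracMatrixSourceTimeSlice

section Generic

open scoped Kronecker

variable {X Y : Type*} [Fintype X] [DecidableEq X] [Fintype Y] [DecidableEq Y]

/-- A colour lift `1_X ⊗ u(x) ⊗ 1_spin` (block-diagonal in `X`, identity in spin) commutes with a
spin lift `1_X ⊗ 1_Y ⊗ S` on `X × Y × Fin 4`: transported along `Equiv.prodAssoc` they are the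
Kronecker products `w ⊗ 1` and `1 ⊗ S`. [folklore] -/
theorem colourLift_comm_spinLift (u : X → Matrix Y Y ℂ) (S : Matrix (Fin 4) (Fin 4) ℂ) :
    (Matrix.of fun a b : X × Y × Fin 4 =>
          if a.1 = b.1 ∧ a.2.2 = b.2.2 then u a.1 a.2.1 b.2.1 else 0) *
        (Matrix.of fun a b : X × Y × Fin 4 =>
          if a.1 = b.1 ∧ a.2.1 = b.2.1 then S a.2.2 b.2.2 else 0) =
      (Matrix.of fun a b : X × Y × Fin 4 =>
          if a.1 = b.1 ∧ a.2.1 = b.2.1 then S a.2.2 b.2.2 else 0) *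
        (Matrix.of fun a b : X × Y × Fin 4 =>
          if a.1 = b.1 ∧ a.2.2 = b.2.2 then u a.1 a.2.1 b.2.1 else 0) := by
  rw [SliceSpin.of_colour_eq u, SliceSpin.of_spin_eq S, ← map_mul, ← map_mul,
    ← Matrix.mul_kronecker_mul, ← Matrix.mul_kronecker_mul, Matrix.one_mul, Matrix.mul_one,
    Matrix.one_mul, Matrix.mul_one]

/-- Two colour lifts multiply blockwise: if `u' x * u x = 1` for every `x : X`, the product of the
lifts of `u'` and `u` is `1`. [folklore] -/
theorem colourLift_mul_colourLift_eq_one (u' u : X → Matrix Y Y ℂ) (h : ∀ x, u' x * u x = 1) :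
    (Matrix.of fun a b : X × Y × Fin 4 =>
          if a.1 = b.1 ∧ a.2.2 = b.2.2 then u' a.1 a.2.1 b.2.1 else 0) *
        (Matrix.of fun a b : X × Y × Fin 4 =>
          if a.1 = b.1 ∧ a.2.2 = b.2.2 then u a.1 a.2.1 b.2.1 else 0) = 1 := by
  rw [SliceSpin.of_colour_eq u', SliceSpin.of_colour_eq u, ← map_mul, ← Matrix.mul_kronecker_mul,
    Matrix.mul_one, SliceSpin.of_colour_mul_of_colour_eq_one u' u h, Matrix.one_kronecker_one,
    map_one]

end Generic

/-- Scalar bookkeeping of the source term: with `R ↔ P ∧ Q`,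
`[P] u − h₁ − h₂ − s [R] v = [P] (u − [Q] s v) − h₁ − h₂`. [folklore] -/
theorem source_rearrange {P Q R : Prop} {_ : Decidable P} {_ : Decidable Q} {_ : Decidable R}
    (hR : R ↔ P ∧ Q) (u v h₁ h₂ s : ℂ) :
    (if P then u else 0) - h₁ - h₂ - s * (if R then v else 0) =
      (if P then u - (if Q then s * v else 0) else 0) - h₁ - h₂ := by
  by_cases hP : P
  · by_cases hQ : Q
    · rw [if_pos hP, if_pos hP, if_pos hQ, if_pos (hR.2 ⟨hP, hQ⟩)]; ring
    · rw [if_pos hP, if_pos hP, if_neg hQ, if_neg fun h => hQ (hR.1 h).2]; ring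
  · rw [if_neg hP, if_neg hP, if_neg fun h => hP (hR.1 h).1]; ring

/-- Entries of the matrix `[P] s • J`. [folklore] -/
theorem ite_smul_apply {m : Type*} (P : Prop) {_ : Decidable P} (s : ℂ) (J : Matrix m m ℂ)
    (i j : m) : (if P then s • J else 0) i j = if P then s * J i j else 0 := by
  split_ifs <;> rfl

/-- **One flavour, one entry.**  The entry of the `r = 1` Wilson–Dirac matrix `wilsonDirac ρ U m 1`
between the time-split sites `x = (t, y)` and `x' = (s, z)`: the same-time slice-operator entry
(mass `m + 4` plus the spatial Wilson hops of slice `t`) for `s = t`, the collapsed forward hop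
`−[y = z] (P⁻)_{αβ} ρ(U((t,y),0))_{ab}` for `s = t + 1`, and the collapsed backward hop
`−[y = z] (P⁺)_{αβ} ρ(U((s,y),0)⁻¹)_{ab}` for `t = s + 1` — the landed brick
`wilsonDirac_submatrix_timeSlice` read entrywise, its Kronecker products `P∓ · W` collapsed by
`TimeSlice.spinLift_mul_colourLift`. [cite: Luscher1977, pp. 283–292] -/
theorem wilsonDirac_cons_apply (Nc L : ℕ) [NeZero L] (G : Type) [Group G]
    (ρ : G →* Matrix (Fin Nc) (Fin Nc) ℂ) (U : GaugeConfig 4 L G) (m : ℝ) (t s : ZMod L)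
    (y z : TorusSite 3 L) (a b : Fin Nc) (α β : Fin 4) :
    wilsonDirac ρ U m 1 ((Fin.cons t y : TorusSite 4 L), a, α) ((Fin.cons s z : TorusSite 4 L), b, β) =
      (if s = t then
          (if (y, a, α) = (z, b, β) then ((m + 4 * 1 : ℝ) : ℂ) else 0) -
            (1 / 2 : ℂ) * ∑ j : Fin 3,
              ((if z = Literature.MathematicalPhysics.QuantumFieldTheory.Site.shift y j then
                  (((1 : ℝ) : ℂ) • (1 : Matrix (Fin 4) (Fin 4) ℂ) - euclideanGamma j.succ) α β *
                    ρ (U ((Fin.cons t y : TorusSite 4 L), j.succ)) a b else 0) +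
                (if y = Literature.MathematicalPhysics.QuantumFieldTheory.Site.shift z j then
                  (((1 : ℝ) : ℂ) • (1 : Matrix (Fin 4) (Fin 4) ℂ) + euclideanGamma j.succ) α β *
                    ρ (U ((Fin.cons t z : TorusSite 4 L), j.succ))⁻¹ a b else 0))
        else 0) -
        (if s = t + 1 then
          (if y = z then ((1 / 2 : ℂ) • (1 - euclideanGamma 0)) α β *
            ρ (U ((Fin.cons t y : TorusSite 4 L), 0)) a b else 0)
        else 0) -
        (if t = s + 1 then
          (if y = z then ((1 / 2 : ℂ) • (1 + euclideanGamma 0)) α β *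
            ρ (U ((Fin.cons s y : TorusSite 4 L), 0))⁻¹ a b else 0)
        else 0) := by
  -- the Kronecker products `P∓ · W` of the brick collapse to `δ_{yz} (P∓)_{αβ} ρ(U)_{ab}`
  have hPmW : ∀ t : ZMod L,
      (Matrix.of fun a b : TorusSite 3 L × Fin Nc × Fin 4 =>
            if a.1 = b.1 ∧ a.2.1 = b.2.1 then ((1 / 2 : ℂ) • (1 - euclideanGamma 0)) a.2.2 b.2.2 else 0) *
          (Matrix.of fun a b : TorusSite 3 L × Fin Nc × Fin 4 => if a.1 = b.1 ∧ a.2.2 = b.2.2 then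
            ρ (U ((Fin.cons t a.1 : TorusSite 4 L), 0)) a.2.1 b.2.1 else 0) =
        Matrix.of fun a b : TorusSite 3 L × Fin Nc × Fin 4 => if a.1 = b.1 then
          ((1 / 2 : ℂ) • (1 - euclideanGamma 0)) a.2.2 b.2.2 *
            ρ (U ((Fin.cons t a.1 : TorusSite 4 L), 0)) a.2.1 b.2.1 else 0 := fun t =>
    TimeSlice.spinLift_mul_colourLift _ fun x => ρ (U ((Fin.cons t x : TorusSite 4 L), 0))
  have hPpW' : ∀ t : ZMod L,
      (Matrix.of fun a b : TorusSite 3 L × Fin Nc × Fin 4 =>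
            if a.1 = b.1 ∧ a.2.1 = b.2.1 then ((1 / 2 : ℂ) • (1 + euclideanGamma 0)) a.2.2 b.2.2 else 0) *
          (Matrix.of fun a b : TorusSite 3 L × Fin Nc × Fin 4 => if a.1 = b.1 ∧ a.2.2 = b.2.2 then
            ρ (U ((Fin.cons t a.1 : TorusSite 4 L), 0))⁻¹ a.2.1 b.2.1 else 0) =
        Matrix.of fun a b : TorusSite 3 L × Fin Nc × Fin 4 => if a.1 = b.1 then
          ((1 / 2 : ℂ) • (1 + euclideanGamma 0)) a.2.2 b.2.2 *
            ρ (U ((Fin.cons t a.1 : TorusSite 4 L), 0))⁻¹ a.2.1 b.2.1 else 0 := fun t =>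
    TimeSlice.spinLift_mul_colourLift _ fun x => ρ (U ((Fin.cons t x : TorusSite 4 L), 0))⁻¹
  have h := Matrix.ext_iff.mpr (wilsonDirac_submatrix_timeSlice Nc L G ρ U m) (t, y, a, α) (s, z, b, β)
  simp only [Matrix.submatrix_apply, Matrix.of_apply] at h
  rw [hPmW, hPpW'] at h
  simpa only [Matrix.of_apply] using h

end StubDiracMatrixSourceTimeSlice

/-- **E2 γ0: the `N_f`-flavour Wilson–Dirac matrix with an equal-time source is a projector
chain.**  For an `SU(3)` gauge field `U` on `(ℤ/L)⁴`, masses `mq`, a time `t₀` and an arbitrary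
source block `Jsl` on the slice index `(flavour × (ℤ/L)³) × colour × spin`,
`det (diracMatrix U mq − s · J^{(t₀)})` (the source supported on the equal times `x₀ = y₀ = t₀`)
is the determinant of the Wilson-type projector chain on `ℤ/L × ((flavour × (ℤ/L)³) × colour × spin)`
with flavour-block-diagonal slice operators `A_t` (mass `mq f` on block `f`), flavour- and
spin-blind transporters `W_t = ρ(U((t,·),0))`, `W'_t = ρ(U((t,·),0))⁻¹`, lifted projections
`P± = ½(1 ± γ₀)`, and the source entering only the diagonal block at `t₀` as `A_{t₀} − s · Jsl`;
moreover `W_t`, `W'_t` commute with `P±` and `W'_t W_t = W_t W'_t = 1` (the hypotheses of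
`det_projChain`).  The statement is the registered stub signature verbatim.
[cite: Luscher1977, pp. 283–292] -/
theorem stub_diracMatrix_source_timeSlice :
    ∀ (Nf L : ℕ) [NeZero L] (U : GaugeConfig 4 L (Matrix.specialUnitaryGroup (Fin 3) ℂ)) (mq : Fin Nf → ℝ)
      (t₀ : ZMod L) (Jsl : Matrix ((Fin Nf × TorusSite 3 L) × Fin 3 × Fin 4) ((Fin Nf × TorusSite 3 L) × Fin 3 × Fin 4) ℂ)
      (s : ℂ),
      let Pp : Matrix ((Fin Nf × TorusSite 3 L) × Fin 3 × Fin 4) ((Fin Nf × TorusSite 3 L) × Fin 3 × Fin 4) ℂ :=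
        Matrix.of fun a b => if a.1 = b.1 ∧ a.2.1 = b.2.1 then ((1 / 2 : ℂ) • (1 + euclideanGamma 0)) a.2.2 b.2.2 else 0;
      let Pm : Matrix ((Fin Nf × TorusSite 3 L) × Fin 3 × Fin 4) ((Fin Nf × TorusSite 3 L) × Fin 3 × Fin 4) ℂ :=
        Matrix.of fun a b => if a.1 = b.1 ∧ a.2.1 = b.2.1 then ((1 / 2 : ℂ) • (1 - euclideanGamma 0)) a.2.2 b.2.2 else 0;
      let W : ZMod L → Matrix ((Fin Nf × TorusSite 3 L) × Fin 3 × Fin 4) ((Fin Nf × TorusSite 3 L) × Fin 3 × Fin 4) ℂ :=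
        fun t => Matrix.of fun a b => if a.1 = b.1 ∧ a.2.2 = b.2.2 then
          fundamentalRep (Fin 3) (U ((Fin.cons t a.1.2 : TorusSite 4 L), 0)) a.2.1 b.2.1 else 0;
      let W' : ZMod L → Matrix ((Fin Nf × TorusSite 3 L) × Fin 3 × Fin 4) ((Fin Nf × TorusSite 3 L) × Fin 3 × Fin 4) ℂ :=
        fun t => Matrix.of fun a b => if a.1 = b.1 ∧ a.2.2 = b.2.2 then
          fundamentalRep (Fin 3) (U ((Fin.cons t a.1.2 : TorusSite 4 L), 0))⁻¹ a.2.1 b.2.1 else 0;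
      let A : ZMod L → Matrix ((Fin Nf × TorusSite 3 L) × Fin 3 × Fin 4) ((Fin Nf × TorusSite 3 L) × Fin 3 × Fin 4) ℂ :=
        fun t => Matrix.of fun a b => if a.1.1 = b.1.1 then
          ((if a = b then ((mq a.1.1 + 4 * 1 : ℝ) : ℂ) else 0) -
            (1 / 2 : ℂ) * ∑ j : Fin 3,
              ((if b.1.2 = Literature.MathematicalPhysics.QuantumFieldTheory.Site.shift a.1.2 j then
                  (((1 : ℝ) : ℂ) • (1 : Matrix (Fin 4) (Fin 4) ℂ) - euclideanGamma j.succ) a.2.2 b.2.2 *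
                    fundamentalRep (Fin 3) (U ((Fin.cons t a.1.2 : TorusSite 4 L), j.succ)) a.2.1 b.2.1 else 0) +
                (if a.1.2 = Literature.MathematicalPhysics.QuantumFieldTheory.Site.shift b.1.2 j then
                  (((1 : ℝ) : ℂ) • (1 : Matrix (Fin 4) (Fin 4) ℂ) + euclideanGamma j.succ) a.2.2 b.2.2 *
                    fundamentalRep (Fin 3) (U ((Fin.cons t b.1.2 : TorusSite 4 L), j.succ))⁻¹ a.2.1 b.2.1 else 0)))
          else 0;
      (diracMatrix U mq - s • Matrix.reindex quarkEquiv quarkEquiv (Matrix.of fun v w : QuarkVar Nf L =>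
          if v.2.1 0 = t₀ ∧ w.2.1 0 = t₀ then Jsl ((v.1, Fin.tail v.2.1), v.2.2) ((w.1, Fin.tail w.2.1), w.2.2) else 0)).det =
        (Matrix.of fun p q : ZMod L × ((Fin Nf × TorusSite 3 L) × Fin 3 × Fin 4) =>
            (if q.1 = p.1 then (A p.1 - if p.1 = t₀ then s • Jsl else 0) p.2 q.2 else 0) -
              (if q.1 = p.1 + 1 then (Pm * W p.1) p.2 q.2 else 0) -
              (if p.1 = q.1 + 1 then (Pp * W' q.1) p.2 q.2 else 0)).det ∧
        (∀ t, W t * Pp = Pp * W t) ∧ (∀ t, W t * Pm = Pm * W t) ∧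
        (∀ t, W' t * Pp = Pp * W' t) ∧ (∀ t, W' t * Pm = Pm * W' t) ∧ (∀ t, W' t * W t = 1) ∧ (∀ t, W t * W' t = 1) := by
  intro Nf L _ U mq t₀ Jsl s Pp Pm W W' A
  /- (1) The temporal hops commute with the lifted projections and are mutually inverse:
    Kronecker bookkeeping with site factor `X = Fin Nf × TorusSite 3 L`. -/
  have hWPp : ∀ t, W t * Pp = Pp * W t := fun t =>
    StubDiracMatrixSourceTimeSlice.colourLift_comm_spinLift
      (fun x : Fin Nf × TorusSite 3 L => fundamentalRep (Fin 3) (U ((Fin.cons t x.2 : TorusSite 4 L), 0))) _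
  have hWPm : ∀ t, W t * Pm = Pm * W t := fun t =>
    StubDiracMatrixSourceTimeSlice.colourLift_comm_spinLift
      (fun x : Fin Nf × TorusSite 3 L => fundamentalRep (Fin 3) (U ((Fin.cons t x.2 : TorusSite 4 L), 0))) _
  have hW'Pp : ∀ t, W' t * Pp = Pp * W' t := fun t =>
    StubDiracMatrixSourceTimeSlice.colourLift_comm_spinLift
      (fun x : Fin Nf × TorusSite 3 L =>
        fundamentalRep (Fin 3) (U ((Fin.cons t x.2 : TorusSite 4 L), 0))⁻¹) _
  have hW'Pm : ∀ t, W' t * Pm = Pm * W' t := fun t =>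
    StubDiracMatrixSourceTimeSlice.colourLift_comm_spinLift
      (fun x : Fin Nf × TorusSite 3 L =>
        fundamentalRep (Fin 3) (U ((Fin.cons t x.2 : TorusSite 4 L), 0))⁻¹) _
  have hW'W : ∀ t, W' t * W t = 1 := fun t =>
    StubDiracMatrixSourceTimeSlice.colourLift_mul_colourLift_eq_one
      (fun x : Fin Nf × TorusSite 3 L =>
        fundamentalRep (Fin 3) (U ((Fin.cons t x.2 : TorusSite 4 L), 0))⁻¹)
      (fun x : Fin Nf × TorusSite 3 L => fundamentalRep (Fin 3) (U ((Fin.cons t x.2 : TorusSite 4 L), 0)))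
      fun x => by rw [← map_mul, inv_mul_cancel, map_one]
  have hWW' : ∀ t, W t * W' t = 1 := fun t =>
    StubDiracMatrixSourceTimeSlice.colourLift_mul_colourLift_eq_one
      (fun x : Fin Nf × TorusSite 3 L => fundamentalRep (Fin 3) (U ((Fin.cons t x.2 : TorusSite 4 L), 0)))
      (fun x : Fin Nf × TorusSite 3 L =>
        fundamentalRep (Fin 3) (U ((Fin.cons t x.2 : TorusSite 4 L), 0))⁻¹)
      fun x => by rw [← map_mul, mul_inv_cancel, map_one]
  refine ⟨?_, hWPp, hWPm, hW'Pp, hW'Pm, hW'W, hWW'⟩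
  /- (2) Collapsed Kronecker form of the hops `P⁻ · W_t`, `P⁺ · W'_t`:
    `δ_{(f,y),(g,z)} (P∓)_{αβ} ρ(U)_{ab}`. -/
  have hPmW : ∀ t, Pm * W t = Matrix.of fun a b : (Fin Nf × TorusSite 3 L) × Fin 3 × Fin 4 =>
      if a.1 = b.1 then ((1 / 2 : ℂ) • (1 - euclideanGamma 0)) a.2.2 b.2.2 *
        fundamentalRep (Fin 3) (U ((Fin.cons t a.1.2 : TorusSite 4 L), 0)) a.2.1 b.2.1 else 0 := fun t =>
    TimeSlice.spinLift_mul_colourLift _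
      fun x : Fin Nf × TorusSite 3 L => fundamentalRep (Fin 3) (U ((Fin.cons t x.2 : TorusSite 4 L), 0))
  have hPpW' : ∀ t, Pp * W' t = Matrix.of fun a b : (Fin Nf × TorusSite 3 L) × Fin 3 × Fin 4 =>
      if a.1 = b.1 then ((1 / 2 : ℂ) • (1 + euclideanGamma 0)) a.2.2 b.2.2 *
        fundamentalRep (Fin 3) (U ((Fin.cons t a.1.2 : TorusSite 4 L), 0))⁻¹ a.2.1 b.2.1 else 0 := fun t =>
    TimeSlice.spinLift_mul_colourLift _
      fun x : Fin Nf × TorusSite 3 L => fundamentalRep (Fin 3) (U ((Fin.cons t x.2 : TorusSite 4 L), 0))⁻¹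
  /- (3) The Dirac part, entrywise: equal flavours reduce to the one-flavour brick, distinct
    flavours vanish on both sides. -/
  have hD : ∀ (t s' : ZMod L) (f g : Fin Nf) (y z : TorusSite 3 L) (a b : Fin 3) (α β : Fin 4),
      diracMatrix U mq (quarkEquiv (f, ((Fin.cons t y : TorusSite 4 L), a, α)))
          (quarkEquiv (g, ((Fin.cons s' z : TorusSite 4 L), b, β))) =
        (if s' = t then A t ((f, y), a, α) ((g, z), b, β) else 0) -
          (if s' = t + 1 then (Pm * W t) ((f, y), a, α) ((g, z), b, β) else 0) -
          (if t = s' + 1 then (Pp * W' s') ((f, y), a, α) ((g, z), b, β) else 0) := by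
    intro t s' f g y z a b α β
    rw [hPmW, hPpW']
    simp only [diracMatrix, Matrix.reindex_apply, Matrix.submatrix_apply, Equiv.symm_apply_apply,
      Matrix.of_apply, A]
    by_cases hfg : f = g
    · subst hfg
      rw [StubDiracMatrixSourceTimeSlice.wilsonDirac_cons_apply]
      simp only [if_true, Prod.mk.injEq, true_and]
    · simp only [hfg, if_false, Prod.mk.injEq, false_and, ite_self, sub_zero]
  /- (4) The source part, entrywise. -/
  have hJ : ∀ (t s' : ZMod L) (f g : Fin Nf) (y z : TorusSite 3 L) (a b : Fin 3) (α β : Fin 4),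
      Matrix.reindex quarkEquiv quarkEquiv (Matrix.of fun v w : QuarkVar Nf L =>
          if v.2.1 0 = t₀ ∧ w.2.1 0 = t₀ then
            Jsl ((v.1, Fin.tail v.2.1), v.2.2) ((w.1, Fin.tail w.2.1), w.2.2) else 0)
          (quarkEquiv (f, ((Fin.cons t y : TorusSite 4 L), a, α)))
          (quarkEquiv (g, ((Fin.cons s' z : TorusSite 4 L), b, β))) =
        if t = t₀ ∧ s' = t₀ then Jsl ((f, y), a, α) ((g, z), b, β) else 0 := by
    intro t s' f g y z a b α β
    simp only [Matrix.reindex_apply, Matrix.submatrix_apply, Equiv.symm_apply_apply, Matrix.of_apply,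
      Fin.cons_zero, Fin.tail_cons]
  /- (5) Reindex along the time/flavour splitting `(t, ((f, y), c)) ↦ quarkEquiv (f, ((t, y), c))`
    (an equivalence, inverse `(f, (x, c)) ↦ (x 0, ((f, Fin.tail x), c))`) and compare entrywise. -/
  have hdet : ∀ M : Matrix (FermiIdx Nf L) (FermiIdx Nf L) ℂ, M.det =
      (M.submatrix
        (fun p : ZMod L × ((Fin Nf × TorusSite 3 L) × Fin 3 × Fin 4) =>
          quarkEquiv (p.2.1.1, ((Fin.cons p.1 p.2.1.2 : TorusSite 4 L), p.2.2)))
        (fun p : ZMod L × ((Fin Nf × TorusSite 3 L) × Fin 3 × Fin 4) =>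
          quarkEquiv (p.2.1.1, ((Fin.cons p.1 p.2.1.2 : TorusSite 4 L), p.2.2)))).det := fun M =>
    (Matrix.det_submatrix_equiv_self
      ((⟨fun p => (p.2.1.1, ((Fin.cons p.1 p.2.1.2 : TorusSite 4 L), p.2.2)),
          fun v => (v.2.1 0, ((v.1, Fin.tail v.2.1), v.2.2)),
          fun ⟨t, ⟨f, y⟩, c⟩ => by simp, fun ⟨f, x, c⟩ => by simp⟩ :
          ZMod L × ((Fin Nf × TorusSite 3 L) × Fin 3 × Fin 4) ≃ QuarkVar Nf L).trans quarkEquiv) M).symm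
  rw [hdet]
  congr 1
  ext ⟨t, ⟨f, y⟩, a, α⟩ ⟨s', ⟨g, z⟩, b, β⟩
  simp only [Matrix.submatrix_apply, Matrix.sub_apply, Matrix.smul_apply, smul_eq_mul, hD, hJ,
    Matrix.of_apply, StubDiracMatrixSourceTimeSlice.ite_smul_apply]
  exact StubDiracMatrixSourceTimeSlice.source_rearrange
    ⟨fun h => ⟨h.2.trans h.1.symm, h.1⟩, fun h => ⟨h.2, h.1.trans h.2⟩⟩ _ _ _ _ _

end Summit.QuantumFields.QCD.Cruxes.RobustYangMillsHandover.PinTheInfimum
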